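import Summits.QuantumFields.YangMills.Theorems.UnitScaleTiltFlatPortAllSizesCol
import Summits.QuantumFields.YangMills.Theorems.UnitScaleTiltProp8FlatPortColumnLetterAllL
import Summits.QuantumFields.YangMills.Theorems.UnitScaleTiltProp8FlatPortCurlCurlPairingAllL
import HarnessLib

/-!
# Route `UnitScaleTilt`, crux K1 «MinimiserStabilityRegPr» (stmt-QuantumFields-19200), leaf `stub_halvingStep` — (P2-small) ∧ (P2-L3) TOGETHER for the column ports (★★OWNER RULINGS
# g26-№18∕№21∕№22, ACK 36 α6b + LF-1 α8-col): **THE (X2-H) COLUMN INPUTS AND THE (X2-CH) PAIRING ROW WITH NEITHER THE TORUS-SIZE FLOOR NOR THE `L ≥ 5` FLOOR**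

Cell `ym3-torus` (HUMAN RULING D-0037, YM ladder rung R3 — continuum SU(2) YM₃ on the torus is a RUNG, not the Clay problem), explicit-unit helper seat `ym-ust-19200-w4` gen 3.
Def-free; `--supports stmt-QuantumFields-19200 --as helper`; counts toward nothing by itself.

✓`FlatPortAllSizesCol.columnInputs_of_adm22_allSizes` ∕ `curlCurlPairing_of_adm22_allSizes` (α6b) removed `a′ + 3 ≤ m + n` by the covering branch but kept `hℓ : 4 ≤ ℓ`, threaded from the
L0 ports; ym-inputs-p09's ✓T8 `FlatPortColumnLetterAllL.columnInputs_of_adm22_allL` ∕ ✓T9 `FlatPortCurlCurlPairingAllL.curlCurlPairing_of_adm22_allL` removed `hℓ` (lit-balaban's V1L3 chart,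
[Balaban1984PropagatorsII] Cor. 2.8 for every odd `L ≥ 3`) but kept the size binder.  Here: both at once — α6b's §3 VERBATIM over the `_allL` ports (the transfer lemmas
`pairing_of_cover`, `columnInputs_of_cover`, `adm22_reduce`, `gradHyp_lift`, `valLift` and the key lemma ✓`CoverFlatH.flatH_cover` are `L`-floor-free already).
* ★★★ `curlCurlPairing_of_adm22_allSizes_allL (ℓ) (hL)` — SAME `CP`; ★★★ `columnInputs_of_adm22_allSizes_allL (ℓ) (hL)` — `K₀ ↦ K₀·(L^{Mh₀+2})³` inside the `∃`.
HONEST SCOPE: binder deletion by re-pointing two suppliers; nothing of print is asserted; NOT a claim about the stub, the crux or the gap.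

References: T. Bałaban, CMP **96** (1984) 223–250 [Balaban1984PropagatorsII] ((2.1)–(2.4) p.224, (2.19) p.226, Cor. 2.8 (2.150)–(2.151) p.249); CMP **102** (1985) 277–309
[Balaban1985Variational] ((46) p.285, (88)–(90) pp.291–292, (161)–(163) p.303).
-/

open scoped BigOperators

noncomputable section

namespace Summit.QuantumFields.YangMills.Theorems.FlatPortAllSizesCol

open Literature.MathematicalPhysics.QuantumFieldTheory.Balaban1983to89
open B6SectADomainsV1 (Domains)
open B6SectAOperatorsV1 (BondIdx SiteIdx dcE dcsE)
open B5Eq118OneStroke (iterBlockOf)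
open B6GlobalChartV1 (PV)
open T3ContinuumYM3Torus (T3Family)
open FlatCubeOpsText (Adm22 IsLevWeight)
open FlatOpsLettersAssembly (flatH)
open CoverSites (cover projBond)
open CoverDomains (projIdx adm22_comap isLevWeight_comap)

/-- `1 ≤ 2 + 1` (the `PV 2 …` dimension side condition, as in the port files). [folklore] -/
private theorem hd3 : 1 ≤ 2 + 1 := by norm_num

/-- ★★★ **(P-5) WITHOUT THE TORUS-SIZE FLOOR, EVERY ODD `L ≥ 3`**: ✓`FlatPortCurlCurlPairingAllL.curlCurlPairing_of_adm22_allL` (ym-inputs-p09 T9, `hℓ`-free) with the binder `a′ + 3 ≤ m + n` DELETED and the SAME `CP`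
(threshold `Mh₀ ↦ L^{Mh₀}`, `R₀` unchanged): a member above the floor (after the `a′`-reduction) is the port's; a member below it is read on its `L^{jc}`-fold cover,
`jc = Mh₀ + 3 − m − n`, through `pairing_of_cover` and the key lemma of the branch ✓`CoverFlatH.flatH_cover` (★w1-20520 g5 ∕ LEAD, unconditional).
[cite: Balaban1985Variational, (88)–(90) pp.291–292, (161) p.303; Balaban1984PropagatorsII, (2.19) p.226, Cor. 2.8 (2.150)–(2.151) p.249] -/
theorem curlCurlPairing_of_adm22_allSizes_allL (ℓ : ℕ) (hL : Odd (ℓ + 1) ∧ 1 < ℓ + 1) :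
    ∃ (Mh₀ R₀ : ℕ) (CP : ℝ), 0 ≤ CP ∧
    ∀ (m : ℕ) (hm : 1 ≤ m) (n K : ℕ) (_ : 1 ≤ K - n) (_ : K - n + 1 ≤ m + K) {Mh R a' : ℕ} (_ : Mh = (ℓ + 1) ^ a') (_ : Mh₀ ≤ Mh) (_ : R₀ ≤ R)
      (D : Domains (PV 2 ℓ m K hd3 hL)) (_ : D.k = K - n) (_ : Adm22 D R ((ℓ + 1) * Mh))
      (w : ℕ → PBond (PV 2 ℓ m K hd3 hL) 0 → ℝ) (_ : IsLevWeight (⟨ℓ + 1, hL, m, hm⟩ : T3Family) n K D w)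
      (Z : PBond (PV 2 ℓ m K hd3 hL) 0 → ℝ) (s : ℝ) (_ : 0 ≤ s)
      (_ : ∀ (b : PBond (PV 2 ℓ m K hd3 hL) 0) (ν : Fin (2 + 1)), w 2 b * (((ℓ + 1 : ℕ) : ℝ)) ^ (K - n) * |Z ⟨b.src.shift ν, b.dir⟩ - Z b| ≤ s)
      (X : BondIdx D → ℝ),
        |∑ b : PBond (PV 2 ℓ m K hd3 hL) 0, (dcsE ((((ℓ + 1 : ℕ) : ℝ)) ^ (K - n)) (dcE ((((ℓ + 1 : ℕ) : ℝ)) ^ (K - n))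
            (WithLp.toLp 2 (flatH (⟨ℓ + 1, hL, m, hm⟩ : T3Family) n K D X)))) b * Z b| ≤
          CP * ((((ℓ + 1 : ℕ) : ℝ)) ^ (K - n)) ^ 3 * s * ∑ c, |X c| := by
  obtain ⟨Mh₀, R₀, CP, hCP, hmain⟩ := FlatPortCurlCurlPairingAllL.curlCurlPairing_of_adm22_allL ℓ hL
  have hL2 : 2 ≤ ℓ + 1 := hL.2
  refine ⟨(ℓ + 1) ^ Mh₀, R₀, CP, hCP, ?_⟩
  intro m hm n K hk1 hk' Mh R a' hMha hMh hR D hDk hAdm w hw Z s hs hZ X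
  -- the `a′`-reduction to `a₀ := Mh₀`
  have ha : Mh₀ ≤ a' := le_of_pow_le_pow hL2 (by rw [← hMha]; exact hMh)
  have hMh₀ : Mh₀ ≤ (ℓ + 1) ^ Mh₀ := (Nat.lt_pow_self (by omega)).le
  have hR' : R₀ ≤ R * (ℓ + 1) ^ (a' - Mh₀) := hR.trans (Nat.le_mul_of_pos_right _ (pow_pos (by omega) _))
  rw [hMha] at hAdm
  have hAdm' : Adm22 D (R * (ℓ + 1) ^ (a' - Mh₀)) ((ℓ + 1) * (ℓ + 1) ^ Mh₀) := adm22_reduce D ha hAdm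
  by_cases hsz : Mh₀ + 3 ≤ m + n
  · -- above the floor: the port itself
    exact hmain m hm n K hk1 hk' rfl hMh₀ hR' hsz D hDk hAdm' w hw Z s hs hZ X
  · -- below the floor: read on the `L^{jc}`-fold cover
    set jc : ℕ := Mh₀ + 3 - (m + n) with hjc
    have hsz' : Mh₀ + 3 ≤ (m + jc) + n := by omega
    have hup := hmain (m + jc) (by omega) n K hk1 (by omega) rfl hMh₀ hR' hsz' (D.comap jc) hDk
      (adm22_comap D jc ⟨Mh₀ + 1, by ring⟩ hAdm') (fun i bt => w i (projBond (PV 2 ℓ m K hd3 hL) jc 0 bt))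
      (isLevWeight_comap (⟨ℓ + 1, hL, m, hm⟩ : T3Family) n K jc D hw)
      (fun bt => Z (projBond (PV 2 ℓ m K hd3 hL) jc 0 bt)) s hs (fun bt ν => gradHyp_lift jc hZ bt ν) (X ∘ projIdx D jc)
    exact pairing_of_cover (⟨ℓ + 1, hL, m, hm⟩ : T3Family) n K jc D
      (fun X bt => CoverFlatH.flatH_cover (⟨ℓ + 1, hL, m, hm⟩ : T3Family) n K jc D X bt) Z X hup


/-- ★★★ **(P-4) WITHOUT THE TORUS-SIZE FLOOR, EVERY ODD `L ≥ 3`**: ✓`FlatPortColumnLetterAllL.columnInputs_of_adm22_allL` (ym-inputs-p09 T8, `hℓ`-free) with the binder `a′ + 3 ≤ m + n` DELETED (threshold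
`Mh₀ ↦ L^{Mh₀}`, `R₀` unchanged, `K₀ ↦ K₀·(L^{Mh₀+2})³` — the deck factor of the cover, `jc ≤ Mh₀ + 2`; the displayed shape of the column bound is VERBATIM the port's): above the floor the port's majorant (its column bound weakened to the larger
constant); below it the descended majorant of `columnInputs_of_cover` on the `L^{jc}`-fold cover, key lemma ✓`CoverFlatH.flatH_cover`.
[cite: Balaban1984PropagatorsII, (2.1)–(2.4) p.224, Cor. 2.8 (2.150)–(2.151) p.249; Balaban1985Variational, (46) p.285, (161)–(163) p.303] -/
theorem columnInputs_of_adm22_allSizes_allL (ℓ : ℕ) (hL : Odd (ℓ + 1) ∧ 1 < ℓ + 1) :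
    ∃ (Mh₀ R₀ : ℕ) (K₀ : ℝ), 0 ≤ K₀ ∧
    ∀ (m : ℕ) (hm : 1 ≤ m) (n K : ℕ) (_ : 1 ≤ K - n) (_ : K - n + 1 ≤ m + K) {Mh R a' : ℕ} (_ : Mh = (ℓ + 1) ^ a') (_ : Mh₀ ≤ Mh) (_ : R₀ ≤ R)
      (D : Domains (PV 2 ℓ m K hd3 hL)) (_ : D.k = K - n) (_ : Adm22 D R ((ℓ + 1) * Mh))
      (w : ℕ → PBond (PV 2 ℓ m K hd3 hL) 0 → ℝ) (_ : IsLevWeight (⟨ℓ + 1, hL, m, hm⟩ : T3Family) n K D w),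
      ∃ ks : Site (PV 2 ℓ m K hd3 hL) 0 → BondIdx D → ℝ,
        (∀ x c, 0 ≤ ks x c) ∧
        (∀ (c : BondIdx D) (b : PBond (PV 2 ℓ m K hd3 hL) 0), |flatH (⟨ℓ + 1, hL, m, hm⟩ : T3Family) n K D (Pi.single c 1) b| ≤ ks b.src c) ∧
        (∀ (c : BondIdx D) (s : SiteIdx D) (x x' : Site (PV 2 ℓ m K hd3 hL) 0), iterBlockOf (s.1.1 : ℕ) x = s.1.2 → iterBlockOf (s.1.1 : ℕ) x' = s.1.2 →
          ks x c = ks x' c) ∧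
        ∀ c : BondIdx D, ∑ b : PBond (PV 2 ℓ m K hd3 hL) 0, (w 3 b)⁻¹ * ks b.src c ≤
          K₀ * (((((ℓ + 1 : ℕ) : ℝ))⁻¹) ^ (K - n))⁻¹ ^ 3 := by
  obtain ⟨Mh₀, R₀, K₀, hK₀, hmain⟩ := FlatPortColumnLetterAllL.columnInputs_of_adm22_allL ℓ hL
  have hL2 : 2 ≤ ℓ + 1 := hL.2
  set Nmax : ℝ := ((((ℓ + 1) ^ (Mh₀ + 2)) ^ 3 : ℕ) : ℝ) with hNmax
  have hN1 : 1 ≤ Nmax := by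
    rw [hNmax]; exact_mod_cast Nat.one_le_pow _ _ (pow_pos (by omega) _)
  refine ⟨(ℓ + 1) ^ Mh₀, R₀, K₀ * Nmax, by positivity, ?_⟩
  intro m hm n K hk1 hk' Mh R a' hMha hMh hR D hDk hAdm w hw
  set E : ℝ := (((((ℓ + 1 : ℕ) : ℝ))⁻¹) ^ (K - n))⁻¹ ^ 3 with hE
  have hE0 : 0 ≤ E := by positivity
  -- the `a′`-reduction to `a₀ := Mh₀`
  have ha : Mh₀ ≤ a' := le_of_pow_le_pow hL2 (by rw [← hMha]; exact hMh)
  have hMh₀ : Mh₀ ≤ (ℓ + 1) ^ Mh₀ := (Nat.lt_pow_self (by omega)).le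
  have hR' : R₀ ≤ R * (ℓ + 1) ^ (a' - Mh₀) := hR.trans (Nat.le_mul_of_pos_right _ (pow_pos (by omega) _))
  rw [hMha] at hAdm
  have hAdm' : Adm22 D (R * (ℓ + 1) ^ (a' - Mh₀)) ((ℓ + 1) * (ℓ + 1) ^ Mh₀) := adm22_reduce D ha hAdm
  by_cases hsz : Mh₀ + 3 ≤ m + n
  · -- above the floor: the port's majorant, column bound weakened by `Nmax ≥ 1`
    obtain ⟨ks, h0, hK, hblk, hcol⟩ := hmain m hm n K hk1 hk' rfl hMh₀ hR' hsz D hDk hAdm' w hw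
    refine ⟨ks, h0, hK, hblk, fun c => (hcol c).trans ?_⟩
    have : K₀ * E ≤ K₀ * Nmax * E := by nlinarith [mul_nonneg hK₀ hE0]
    exact this
  · -- below the floor: the descended majorant on the `L^{jc}`-fold cover
    set jc : ℕ := Mh₀ + 3 - (m + n) with hjc
    have hsz' : Mh₀ + 3 ≤ (m + jc) + n := by omega
    have hjc2 : jc ≤ Mh₀ + 2 := by omega
    obtain ⟨kst, hks0, hKt, hblkt, hcolt⟩ := hmain (m + jc) (by omega) n K hk1 (by omega) rfl hMh₀ hR' hsz' (D.comap jc) hDk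
      (adm22_comap D jc ⟨Mh₀ + 1, by ring⟩ hAdm') (fun i bt => w i (projBond (PV 2 ℓ m K hd3 hL) jc 0 bt))
      (isLevWeight_comap (⟨ℓ + 1, hL, m, hm⟩ : T3Family) n K jc D hw)
    obtain ⟨ks, h0, hK, hblk, hcol⟩ := columnInputs_of_cover (⟨ℓ + 1, hL, m, hm⟩ : T3Family) n K jc D hw
      (flatH (((⟨ℓ + 1, hL, m, hm⟩ : T3Family)).cover jc) n K (D.comap jc))
      (fun X bt => CoverFlatH.flatH_cover (⟨ℓ + 1, hL, m, hm⟩ : T3Family) n K jc D X bt) kst hks0 hKt hblkt hcolt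
    refine ⟨ks, h0, hK, hblk, fun c => (hcol c).trans ?_⟩
    -- the deck factor `(L^{jc})³ ≤ (L^{Mh₀+2})³`
    have hN : (((((ℓ + 1) ^ jc) ^ 3 : ℕ)) : ℝ) ≤ Nmax := by
      rw [hNmax]; exact_mod_cast Nat.pow_le_pow_left (Nat.pow_le_pow_right (by omega) hjc2) 3
    have h1 : K₀ * (((((ℓ + 1) ^ jc) ^ 3 : ℕ)) : ℝ) * E ≤ K₀ * Nmax * E :=
      mul_le_mul_of_nonneg_right (mul_le_mul_of_nonneg_left hN hK₀) hE0
    exact h1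


end Summit.QuantumFields.YangMills.Theorems.FlatPortAllSizesCol

end
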